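import Mathlib.Analysis.SpecialFunctions.Pow.Real
import Mathlib.Analysis.Normed.Group.Continuity
import Summits.ABC.IUTFork.Joshi.ArithTeichmullerSpace
import HarnessLib

/-!
# [J-I] §3 «not topologically isomorphic (and hence non-isometric)» — PROVED over E-t1's `Untilt`

Proof-only DERIVED row (block E fallback §4.1; seat abc-iut-E-t16) on E-t1's landed carrier file
`Summits/ABC/IUTFork/Joshi/ArithTeichmullerSpace.lean` (p428170: `Joshi.Untilt p`, `Untilt.TopEquiv`, `Untilt.TopIso`). Source:
K. Joshi, *Construction of Arithmetic Teichmüller Spaces I*, arXiv:2106.11452v4 §3 (chunk p0013 of the corpus render;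
quoted in E-t1's `TopEquiv` docstring): untilts of one tilt «are abstractly isomorphic fields but may not be topologically
isomorphic», «not topologically isomorphic (and hence non-isometric)» (bib `Joshi2021ATS1`, UNREFEREED, claim status
`disputed`; the EXISTENCE of non-homeomorphic untilts is the refereed [cite: KedlayaTemkin2018, Thm 1.3] and is NOT used
or asserted here). Typed ≠ proved ≠ endorsed; no side taken on [IUTchIII] Cor. 3.12 or on any author.

WHAT IS PROVED (elementary normed-field topology, Mathlib): for untilts `U, V` (complete ultrametric algebraically closed
normed fields of residue characteristic `p`) and a field isomorphism `e : U.K ≃+* V.K`,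
* `Untilt.topEquivOfNormRpow` / `topIso_of_norm_rpow`: if `‖e x‖ = ‖x‖ ^ s` for some real `s > 0` (an isometry up to
  DILATION of the value group — [J-I] §10 (pa:norm-example) «dilatation factor») then `e` is a homeomorphism, i.e. a
  `TopEquiv`; in particular (`s = 1`, `topIso_of_norm_eq`) an isometric field isomorphism is a topological isomorphism;
* contrapositives `exists_norm_rpow_ne_of_not_topIso` / `exists_norm_ne_of_not_topIso`: between untilts that are NOT
  topologically isomorphic, NO field isomorphism is an isometry, nor a dilated isometry — the parenthetical «hence
  non-isometric», with the dilation strengthening.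
WHY IT IS FILED (block E, E-LOCATION L1): the typed indeterminacy (Ind2) of [IUTchIII] Thm. 3.11 acts through `Ism` =
isometries of `𝒪^{×μ}` (tree `Thm311Sig`, E-t18's `IndDictionary.JInd2InIsm`); Joshi's «change of arithmetic holomorphic
structure» moves between untilts which, when non-homeomorphic, admit no (dilated-)isometric identification AT ALL — the
kernel form of the sentence E-cx's X-06 (`Joshi.not_untiltChange_of_logvolInvariant`) and Mochizuki2024JoshiReport
(ShtAns) disagree about; located, not adjudicated. Standard axioms only; sorry-free. bears_on: LADDER-ABC:A2.E.
-/

noncomputable section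

namespace Summit.ABC.IUTFork.Joshi.Untilt

variable {p : ℕ} [Fact p.Prime]

/-- PROVED (the analytic core): an additive homomorphism between normed groups whose norm is a positive power of the
source norm, `‖f x‖ = ‖x‖ ^ s` with `s > 0`, is continuous (continuity at `0` with `δ := ε^{1/s}`, then translate). -/
theorem continuous_of_norm_rpow {A B : Type} [SeminormedAddCommGroup A] [SeminormedAddCommGroup B] (f : A →+ B)
    {s : ℝ} (hs : 0 < s) (h : ∀ x, ‖f x‖ = ‖x‖ ^ s) : Continuous f := by
  refine continuous_of_continuousAt_zero f ?_
  rw [Metric.continuousAt_iff]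
  intro ε hε
  refine ⟨ε ^ (1 / s), Real.rpow_pos_of_pos hε _, fun {x} hx => ?_⟩
  rw [dist_zero_right] at hx
  rw [map_zero, dist_zero_right, h x]
  calc ‖x‖ ^ s < (ε ^ (1 / s)) ^ s := Real.rpow_lt_rpow (norm_nonneg x) hx hs
    _ = ε := by rw [← Real.rpow_mul hε.le, one_div_mul_cancel hs.ne', Real.rpow_one]

/-- PROVED: if `‖e x‖ = ‖x‖ ^ s` (`s > 0`) for a field isomorphism `e`, then the inverse satisfies `‖e⁻¹ y‖ = ‖y‖ ^ (1/s)`. -/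
theorem norm_symm_rpow {U V : Untilt p} (e : U.K ≃+* V.K) {s : ℝ} (hs : 0 < s) (h : ∀ x, ‖e x‖ = ‖x‖ ^ s)
    (y : V.K) : ‖e.symm y‖ = ‖y‖ ^ (1 / s) := by
  have hy : ‖y‖ = ‖e.symm y‖ ^ s := by simpa using h (e.symm y)
  rw [hy, ← Real.rpow_mul (norm_nonneg _), mul_one_div_cancel hs.ne', Real.rpow_one]

/-- CONSTRUCTED — **a dilated isometry is a topological isomorphism**: a field isomorphism of untilts with
`‖e x‖ = ‖x‖ ^ s`, `s > 0` ([J-I] §10 «dilatation» of the value group included), is a `TopEquiv` (E-t1's structure: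
continuous with continuous inverse). [claim: Joshi2021ATS1, status: disputed] -/
def topEquivOfNormRpow {U V : Untilt p} (e : U.K ≃+* V.K) (s : ℝ) (hs : 0 < s) (h : ∀ x, ‖e x‖ = ‖x‖ ^ s) :
    TopEquiv U V where
  toRingEquiv := e
  continuous_toFun := continuous_of_norm_rpow e.toAddMonoidHom hs h
  continuous_invFun :=
    continuous_of_norm_rpow e.symm.toAddMonoidHom (one_div_pos.mpr hs) (norm_symm_rpow e hs h)

/-- PROVED: untilts related by a dilated isometry are topologically isomorphic (E-t1's `Untilt.TopIso`). -/
theorem topIso_of_norm_rpow {U V : Untilt p} (e : U.K ≃+* V.K) (s : ℝ) (hs : 0 < s)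
    (h : ∀ x, ‖e x‖ = ‖x‖ ^ s) : U.TopIso V :=
  ⟨topEquivOfNormRpow e s hs h⟩

/-- PROVED: untilts related by an ISOMETRIC field isomorphism are topologically isomorphic. -/
theorem topIso_of_norm_eq {U V : Untilt p} (e : U.K ≃+* V.K) (h : ∀ x, ‖e x‖ = ‖x‖) : U.TopIso V :=
  topIso_of_norm_rpow e 1 one_pos fun x => by rw [h x, Real.rpow_one]

/-- PROVED — **«not topologically isomorphic (and hence non-isometric)»** ([J-I] §3, chunk p0013), with the dilation
strengthening: between untilts that are not topologically isomorphic, every field isomorphism moves some norm off every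
power law `‖·‖ ^ s` (`s > 0`). -/
theorem exists_norm_rpow_ne_of_not_topIso {U V : Untilt p} (hUV : ¬ U.TopIso V) (e : U.K ≃+* V.K) (s : ℝ)
    (hs : 0 < s) : ∃ x : U.K, ‖e x‖ ≠ ‖x‖ ^ s := by
  by_contra hall
  push Not at hall
  exact hUV (topIso_of_norm_rpow e s hs hall)

/-- PROVED — the parenthetical itself: between untilts that are not topologically isomorphic, NO field isomorphism is an
isometry. (With E-t1's `ATSObj.not_isIso_of_not_topIso` and the refereed existence of such pairs — KedlayaTemkin2018, typed
by E-t1 as a named fact, not used here — this is the kernel content of Joshi's «many inequivalent … non-isometric»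
arithmetic holomorphic structures.) -/
theorem exists_norm_ne_of_not_topIso {U V : Untilt p} (hUV : ¬ U.TopIso V) (e : U.K ≃+* V.K) :
    ∃ x : U.K, ‖e x‖ ≠ ‖x‖ := by
  obtain ⟨x, hx⟩ := exists_norm_rpow_ne_of_not_topIso hUV e 1 one_pos
  exact ⟨x, by simpa using hx⟩

/-- PROVED (unit-ball form, the shape (Ind2)/`Ism`-type indeterminacies are stated in): between untilts that are not
topologically isomorphic, no field isomorphism preserves the norm of every element of the closed unit ball `𝒪_{K}`
(an isometry on `𝒪` is an isometry everywhere, by inversion). -/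
theorem exists_mem_unitBall_norm_ne_of_not_topIso {U V : Untilt p} (hUV : ¬ U.TopIso V) (e : U.K ≃+* V.K) :
    ∃ x : U.K, ‖x‖ ≤ 1 ∧ ‖e x‖ ≠ ‖x‖ := by
  by_contra hall
  push Not at hall
  refine (exists_norm_ne_of_not_topIso hUV e).elim fun x hx => hx ?_
  rcases le_or_gt ‖x‖ 1 with hle | hgt
  · exact hall x hle
  · have hinv : ‖x⁻¹‖ ≤ 1 := by
      rw [norm_inv]; exact inv_le_one_of_one_le₀ hgt.le
    have := hall x⁻¹ hinv
    rw [map_inv₀, norm_inv, norm_inv, inv_inj] at this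
    exact this

end Summit.ABC.IUTFork.Joshi.Untilt

end
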